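import Summits.QuantumAdvantage.QuantumAdvantage.Theorems.SosSandwichPseudoBoundedAAChebyshevFamily
import Mathlib.Analysis.Complex.Trigonometric
import Mathlib.Analysis.SpecialFunctions.Trigonometric.Bounds
import HarnessLib

/-!
# Route `SosSandwich`, crux `PseudoBoundedAA` (stmt-QuantumAdvantage-15237): the ℓ¹-sensitivity bound `2d²` is tight up to
# the factor `96/43` — the Chebyshev polynomial of the sign mean

`Theorems/SosSandwichPseudoBoundedAAGradientBound.lean` (`sum_abs_sub_flipBit_le_of_bounded`) bounds the ℓ¹-sensitivity of a
`[0,1]`-valued polynomial of total degree `≤ d` by `2d²` at every vertex.  This file gives the matching LOWER bound, so the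
law is `Θ(d²)`: for `p = (1 + T_d(ȳ))/2` on `N = 6d²` bits (`ȳ = (1/N)Σ_i (1 - 2x_i)` the sign mean, `T_d` the Chebyshev
polynomial; the sibling file `…ChebyshevFamily.lean` supplies `ȳ` and the substitution lemmas), at the all-zero vertex every
single-bit flip moves `ȳ` from `1` to `1 - 2/N` and `p` by `(1 - T_d(1 - 2/N))/2 ≥ (43/96)·d²·(2/N)` (`one_sub_chebyshevT_ge`:
`1 - T_d(1 - h) ≥ (43/48) d² h` for `0 ≤ h ≤ 1/3`, `d² h ≤ 43/96` — `T_d(cos θ) = cos(dθ)` and Mathlib's `Real.cos_bound`), so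
`Σ_i |p(0) - p(0^{⊕i})| ≥ (43/48)·d²` (`exists_sensitivity_ge`).  Ratio to the upper bound: `2 / (43/48) = 96/43 < 2.24`.

Honest label: calibration lemma (tightness of a support inequality); no stub, crux or summit is proved.
Sources: Chebyshev polynomials `T_d(cos θ) = cos dθ`, `T_d'(1) = d²` (the extremal case of Markov's inequality,
Korneichuk 1991 §3.5.4); Nisan–Szegedy 1994 (symmetrisation by the Hamming-weight mean).
-/

-- D-0017: single-conjunct summit ⇒ the duplicate `QuantumAdvantage.QuantumAdvantage` is mandated.
set_option linter.dupNamespace false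

noncomputable section

namespace Summit.QuantumAdvantage.QuantumAdvantage.Theorems.SosSandwich.SensitivityTight

open Finset
open Literature.Computability.QuantumComplexity
open Summit.QuantumAdvantage.QuantumAdvantage.Theorems.SosSandwich

/-! ### §1 `1 - T_d(1 - h) ≥ (43/48)·d²·h` near the endpoint -/

/-- **The Chebyshev polynomial drops at rate `≈ d²` below its endpoint value `T_d(1) = 1`**: for `0 ≤ h ≤ 1/3` with
`d² h ≤ 43/96`, `1 - T_d(1 - h) ≥ (43/48)·d²·h`.  (Write `1 - h = cos θ`, `θ ∈ [0, 1]`; then `T_d(1 - h) = cos(dθ)`,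
`θ² ≥ 2h`, `θ² ≤ (96/43) h` and `cos(dθ) ≤ 1 - (43/96)(dθ)²` by `|cos u - (1 - u²/2)| ≤ (5/96)u⁴` on `|u| ≤ 1`.)
[cite: Korneichuk1991, Thm 3.5.8 (§3.5.4)] -/
theorem one_sub_chebyshevT_ge (d : ℕ) {h : ℝ} (h0 : 0 ≤ h) (h1 : h ≤ 1 / 3) (h2 : (d : ℝ) ^ 2 * h ≤ 43 / 96) :
    (43 / 48 : ℝ) * (d : ℝ) ^ 2 * h ≤ 1 - (Polynomial.Chebyshev.T ℝ (d : ℤ)).eval (1 - h) := by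
  set θ := Real.arccos (1 - h) with hθ
  have hc : Real.cos θ = 1 - h := Real.cos_arccos (by linarith) (by linarith)
  have hT : (Polynomial.Chebyshev.T ℝ (d : ℤ)).eval (1 - h) = Real.cos (d * θ) := by
    rw [← hc, Polynomial.Chebyshev.T_real_cos]
    push_cast
    ring_nf
  have hθ0 : 0 ≤ θ := Real.arccos_nonneg _
  -- `θ ≤ 1` since `cos 1 ≤ 5/9 ≤ 2/3 ≤ 1 - h`
  have hθ1 : θ ≤ 1 := by
    have hcos1 : Real.cos 1 ≤ 1 - h := by linarith [Real.cos_one_le]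
    calc θ = Real.arccos (1 - h) := rfl
      _ ≤ Real.arccos (Real.cos 1) := Real.arccos_le_arccos hcos1
      _ = 1 := Real.arccos_cos (by norm_num) (by linarith [Real.two_le_pi])
  -- `θ² ≥ 2h`
  have hlow : 2 * h ≤ θ ^ 2 := by
    have := Real.one_sub_sq_div_two_le_cos (x := θ)
    rw [hc] at this
    linarith
  -- `θ² ≤ (96/43) h`
  have habsθ : |θ| ≤ 1 := by rw [abs_of_nonneg hθ0]; exact hθ1
  have hθsq1 : θ ^ 2 ≤ 1 := by nlinarith
  have hup : 43 / 96 * θ ^ 2 ≤ h := by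
    have hb := Real.cos_bound habsθ
    rw [hc, abs_of_nonneg hθ0] at hb
    have hb' := (abs_le.mp hb).2
    have h4 : θ ^ 4 ≤ θ ^ 2 := by nlinarith
    nlinarith
  -- `(dθ)² ≤ 1`
  have hd0 : (0 : ℝ) ≤ d := Nat.cast_nonneg d
  have hdθsq : ((d : ℝ) * θ) ^ 2 ≤ 1 := by
    have : (d : ℝ) ^ 2 * θ ^ 2 ≤ (d : ℝ) ^ 2 * (96 / 43 * h) :=
      mul_le_mul_of_nonneg_left (by linarith) (by positivity)
    nlinarith
  have habsdθ : |(d : ℝ) * θ| ≤ 1 := by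
    rw [abs_of_nonneg (by positivity)]
    nlinarith [sq_nonneg ((d : ℝ) * θ - 1), hdθsq, show (0 : ℝ) ≤ d * θ by positivity]
  -- `cos(dθ) ≤ 1 - (43/96)(dθ)²`
  have hcosd : Real.cos (d * θ) ≤ 1 - 43 / 96 * ((d : ℝ) * θ) ^ 2 := by
    have hb := Real.cos_bound habsdθ
    rw [abs_of_nonneg (by positivity : (0 : ℝ) ≤ d * θ)] at hb
    have hb' := (abs_le.mp hb).2
    have h4 : ((d : ℝ) * θ) ^ 4 ≤ ((d : ℝ) * θ) ^ 2 := by nlinarith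
    nlinarith
  rw [hT]
  have hsq : 2 * ((d : ℝ) ^ 2 * h) ≤ ((d : ℝ) * θ) ^ 2 := by
    rw [mul_pow]; nlinarith [mul_le_mul_of_nonneg_left hlow (sq_nonneg (d : ℝ))]
  nlinarith

/-! ### §2 The witness `p = (1 + T_d(ȳ))/2` on `N = 6d²` bits -/

/-- The sign mean of the all-zero vertex is `1`. [folklore] -/
theorem signMean_zero {N : ℕ} (hN : 1 ≤ N) :
    evalBool (∑ i : Fin N, (MvPolynomial.C (1 / (N : ℝ)) -
        MvPolynomial.C (2 / (N : ℝ)) * MvPolynomial.X i)) (fun _ : Fin N => false) = 1 := by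
  rw [evalBool_signMean]
  have hN' : (N : ℝ) ≠ 0 := by exact_mod_cast (by omega : N ≠ 0)
  simp only [Bool.false_eq_true, ↓reduceIte, mul_zero, sub_zero, Finset.sum_const, Finset.card_univ,
    Fintype.card_fin, nsmul_eq_mul, mul_one]
  field_simp

/-- The sign mean after one bit flip of the all-zero vertex is `1 - 2/N`. [folklore] -/
theorem signMean_flipBit_zero {N : ℕ} (hN : 1 ≤ N) (i : Fin N) :
    evalBool (∑ j : Fin N, (MvPolynomial.C (1 / (N : ℝ)) -
        MvPolynomial.C (2 / (N : ℝ)) * MvPolynomial.X j)) (flipBit i fun _ : Fin N => false) = 1 - 2 / (N : ℝ) := by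
  rw [evalBool_signMean]
  have hN' : (N : ℝ) ≠ 0 := by exact_mod_cast (by omega : N ≠ 0)
  have hval : ∀ j : Fin N, (flipBit i (fun _ : Fin N => false)) j = decide (j = i) := by
    intro j
    by_cases hj : j = i
    · subst hj; simp [flipBit]
    · rw [flipBit, Function.update_of_ne hj]; simp [hj]
  simp_rw [hval]
  have hsum : ∑ j : Fin N, (1 - 2 * (if decide (j = i) = true then (1 : ℝ) else 0)) = (N : ℝ) - 2 := by
    have e : ∀ j : Fin N, (1 - 2 * (if decide (j = i) = true then (1 : ℝ) else 0)) =
        1 - (if j = i then (2 : ℝ) else 0) := fun j => by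
      by_cases hj : j = i <;> simp [hj]
    simp_rw [e]
    rw [Finset.sum_sub_distrib, Finset.sum_const, Finset.card_univ, Fintype.card_fin, nsmul_eq_mul, mul_one,
      Finset.sum_ite_eq' Finset.univ i, if_pos (Finset.mem_univ i)]
  rw [hsum]
  field_simp

/-- **The ℓ¹-sensitivity law is tight up to `96/43`.**  For every `d ≥ 1` there is a `[0,1]`-valued real polynomial `p`
of total degree `≤ d` on `N = 6d²` bits — `p = (1 + T_d(ȳ))/2`, `ȳ` the sign mean — whose ℓ¹-sensitivity at the all-zero
vertex is at least `(43/48)·d²`: `Σ_i |p(0) - p(0^{⊕i})| ≥ (43/48)·d²` (upper bound `2d²`,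
`GradientBound.sum_abs_sub_flipBit_le_of_bounded`). [cite: Korneichuk1991, Thm 3.5.8 (§3.5.4)] -/
theorem exists_sensitivity_ge (d : ℕ) (hd : 1 ≤ d) :
    ∃ p : MvPolynomial (Fin (6 * d ^ 2)) ℝ, p.totalDegree ≤ d ∧
      (∀ x, 0 ≤ evalBool p x ∧ evalBool p x ≤ 1) ∧
      (43 / 48 : ℝ) * (d : ℝ) ^ 2 ≤
        ∑ i, |evalBool p (fun _ => false) - evalBool p (flipBit i fun _ => false)| := by
  set N := 6 * d ^ 2 with hNdef
  have hN : 1 ≤ N := by rw [hNdef]; nlinarith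
  have hNR : (N : ℝ) = 6 * (d : ℝ) ^ 2 := by rw [hNdef]; push_cast; ring
  have hNpos : (0 : ℝ) < N := by exact_mod_cast hN
  set s : MvPolynomial (Fin N) ℝ := ∑ i : Fin N, (MvPolynomial.C (1 / (N : ℝ)) -
    MvPolynomial.C (2 / (N : ℝ)) * MvPolynomial.X i) with hs
  set q : MvPolynomial (Fin N) ℝ := Polynomial.aeval s (Polynomial.Chebyshev.T ℝ (d : ℤ)) with hq
  refine ⟨MvPolynomial.C (1 / 2 : ℝ) * (1 + q), ?_, ?_, ?_⟩
  · -- degree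
    refine (MvPolynomial.totalDegree_mul _ _).trans ?_
    rw [MvPolynomial.totalDegree_C, zero_add]
    refine (MvPolynomial.totalDegree_add _ _).trans (max_le ?_ ?_)
    · rw [MvPolynomial.totalDegree_one]; exact Nat.zero_le _
    · refine (totalDegree_aeval_le s _).trans ?_
      rw [Polynomial.Chebyshev.natDegree_T]
      calc (d : ℤ).natAbs * s.totalDegree ≤ d * 1 := Nat.mul_le_mul (by simp) totalDegree_signMean_le
        _ = d := mul_one d
  · -- values in `[0,1]`: `T_d(ȳ) = cos(d · arccos ȳ) ∈ [-1, 1]`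
    intro x
    have hev : evalBool (MvPolynomial.C (1 / 2 : ℝ) * (1 + q)) x =
        1 / 2 * (1 + (Polynomial.Chebyshev.T ℝ (d : ℤ)).eval (evalBool s x)) := by
      rw [hq, ← evalBool_aeval]
      unfold evalBool
      rw [map_mul, MvPolynomial.eval_C, map_add, map_one]
    have hb : |evalBool s x| ≤ 1 := abs_evalBool_signMean_le hN x
    have hcos : (Polynomial.Chebyshev.T ℝ (d : ℤ)).eval (evalBool s x) =
        Real.cos (d * Real.arccos (evalBool s x)) := by
      conv_lhs => rw [← Real.cos_arccos (neg_le_of_abs_le hb) (le_of_abs_le hb)]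
      rw [Polynomial.Chebyshev.T_real_cos]
      simp only [Int.cast_natCast]
    rw [hev, hcos]
    constructor
    · linarith [Real.neg_one_le_cos (d * Real.arccos (evalBool s x))]
    · linarith [Real.cos_le_one (d * Real.arccos (evalBool s x))]
  · -- the sensitivity at the all-zero vertex
    have hev : ∀ x, evalBool (MvPolynomial.C (1 / 2 : ℝ) * (1 + q)) x =
        1 / 2 * (1 + (Polynomial.Chebyshev.T ℝ (d : ℤ)).eval (evalBool s x)) := by
      intro x
      rw [hq, ← evalBool_aeval]
      unfold evalBool
      rw [map_mul, MvPolynomial.eval_C, map_add, map_one]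
    have h0 : evalBool (MvPolynomial.C (1 / 2 : ℝ) * (1 + q)) (fun _ => false) = 1 := by
      rw [hev, hs, signMean_zero hN, Polynomial.Chebyshev.T_eval_one]; norm_num
    have hi : ∀ i : Fin N, evalBool (MvPolynomial.C (1 / 2 : ℝ) * (1 + q)) (flipBit i fun _ => false) =
        1 / 2 * (1 + (Polynomial.Chebyshev.T ℝ (d : ℤ)).eval (1 - 2 / (N : ℝ))) := by
      intro i
      rw [hev, hs, signMean_flipBit_zero hN i]
    -- the Chebyshev drop with `h = 2/N = 1/(3d²)`
    have hh0 : (0 : ℝ) ≤ 2 / N := by positivity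
    have hd1 : (1 : ℝ) ≤ (d : ℝ) ^ 2 := by
      have : (1 : ℝ) ≤ d := by exact_mod_cast hd
      nlinarith
    have hh1 : 2 / (N : ℝ) ≤ 1 / 3 := by
      rw [hNR, div_le_iff₀ (by positivity)]; nlinarith
    have hh2 : (d : ℝ) ^ 2 * (2 / N) ≤ 43 / 96 := by
      rw [hNR]
      have : (d : ℝ) ^ 2 * (2 / (6 * (d : ℝ) ^ 2)) = 1 / 3 := by field_simp; ring
      rw [this]; norm_num
    have hdrop := one_sub_chebyshevT_ge d hh0 hh1 hh2
    have hle1 : (Polynomial.Chebyshev.T ℝ (d : ℤ)).eval (1 - 2 / (N : ℝ)) ≤ 1 := by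
      nlinarith [hdrop, sq_nonneg (d : ℝ)]
    have hterm : ∀ i : Fin N, |evalBool (MvPolynomial.C (1 / 2 : ℝ) * (1 + q)) (fun _ => false) -
        evalBool (MvPolynomial.C (1 / 2 : ℝ) * (1 + q)) (flipBit i fun _ => false)| =
        1 / 2 * (1 - (Polynomial.Chebyshev.T ℝ (d : ℤ)).eval (1 - 2 / (N : ℝ))) := by
      intro i
      rw [h0, hi i, abs_of_nonneg (by linarith)]
      ring
    simp_rw [hterm]
    rw [Finset.sum_const, Finset.card_univ, Fintype.card_fin, nsmul_eq_mul, hNR]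
    -- `6d² · (1/2)(1 - T_d(1 - 2/N)) ≥ 6d² · (1/2) · (43/48) d² · (2/N) = (43/48) d²`
    have hkey : (43 / 48 : ℝ) * (d : ℝ) ^ 2 * (2 / N) ≤
        1 - (Polynomial.Chebyshev.T ℝ (d : ℤ)).eval (1 - 2 / (N : ℝ)) := hdrop
    rw [hNR] at hkey
    have e : 6 * (d : ℝ) ^ 2 * (1 / 2 * ((43 / 48 : ℝ) * (d : ℝ) ^ 2 * (2 / (6 * (d : ℝ) ^ 2)))) =
        (43 / 48 : ℝ) * (d : ℝ) ^ 2 := by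
      field_simp
    calc (43 / 48 : ℝ) * (d : ℝ) ^ 2
        = 6 * (d : ℝ) ^ 2 * (1 / 2 * ((43 / 48 : ℝ) * (d : ℝ) ^ 2 * (2 / (6 * (d : ℝ) ^ 2)))) := e.symm
      _ ≤ 6 * (d : ℝ) ^ 2 * (1 / 2 * (1 - (Polynomial.Chebyshev.T ℝ (d : ℤ)).eval (1 - 2 / (6 * (d : ℝ) ^ 2)))) := by
          apply mul_le_mul_of_nonneg_left _ (by positivity)
          apply mul_le_mul_of_nonneg_left hkey (by norm_num)

end Summit.QuantumAdvantage.QuantumAdvantage.Theorems.SosSandwich.SensitivityTight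

end
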